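import Literature.Barriers.AtomisticToContinuum.FeynmanCyclesVersusCondensationProofs
import HarnessLib

/-!
# Route `ColdStartUniversality`, crux K_A1 `UniformColdStartMixing` (stmt-QuantumFields-24809), line
# `cold_entropy`: support stub `stub_weylEntropySum` — the Weyl-law Gaussian lattice sum

Helper file (seat `ym-line-csu-p1`, item settled: S; this is a `--supports 24809` node of the planner's line
«cold_entropy», registered stub `stub_weylEntropySum`, statement `WeylEntropySum` verbatim):
`Σ_{k ∈ [-n,n]³} e^{-c|k|²} ≤ B(c)` for all `n` — the free-field cold-start entropy budget is bounded UNIFORMLY in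
the momentum box (the cut-off).  Proof: the sum factorises as the cube of `Σ_{|k| ≤ n} e^{-ck²}`, which is bounded
by the convergent Gaussian series over `ℤ` (tree: `BoseGas.IdealGas.summable_exp_neg_mul_intSq`).

No definition, no sorry.  RECORD-rung plumbing; this proves nothing about K_A1 or the mass gap. -/

set_option autoImplicit false

noncomputable section

namespace Summit.QuantumFields.YangMills.Theorems.ColdStartUniversality

open Finset Real
open scoped BigOperators

/-- The box sums `Σ_{k=-n}^{n} e^{-ck²}` are bounded by the full series. [folklore] -/
theorem sum_Icc_exp_neg_mul_sq_le {c : ℝ} (hc : 0 < c) (n : ℕ) :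
    ∑ k ∈ Finset.Icc (-(n : ℤ)) n, Real.exp (-(c * (k : ℝ) ^ 2)) ≤
      ∑' k : ℤ, Real.exp (-(c * (k : ℝ) ^ 2)) :=
  (Literature.Barriers.AtomisticToContinuum.BoseGas.IdealGas.summable_exp_neg_mul_intSq hc).sum_le_tsum _
    fun _ _ => (Real.exp_pos _).le

/-- **`WeylEntropySum` (registered stub `stub_weylEntropySum` of line «cold_entropy», stmt-QuantumFields-24809)**:
the Gaussian lattice sum over the momentum box `[-n, n]³` is bounded uniformly in `n`:
`∀ c > 0, ∃ B, ∀ n, Σ_{k ∈ [-n,n]³} e^{-c(k₁² + k₂² + k₃²)} ≤ B` (with `B = (Σ_{k∈ℤ} e^{-ck²})³`). [folklore] -/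
theorem weylEntropySum :
    ∀ c : ℝ, 0 < c → ∃ B : ℝ, ∀ n : ℕ,
      (∑ k ∈ (Finset.Icc (-(n : ℤ)) n) ×ˢ ((Finset.Icc (-(n : ℤ)) n) ×ˢ (Finset.Icc (-(n : ℤ)) n)),
          Real.exp (-(c * ((k.1 : ℝ) ^ 2 + (k.2.1 : ℝ) ^ 2 + (k.2.2 : ℝ) ^ 2)))) ≤ B := by
  intro c hc
  set S : ℝ := ∑' k : ℤ, Real.exp (-(c * (k : ℝ) ^ 2)) with hS
  refine ⟨S ^ 3, fun n => ?_⟩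
  set A := Finset.Icc (-(n : ℤ)) n with hA
  set T : ℝ := ∑ k ∈ A, Real.exp (-(c * (k : ℝ) ^ 2)) with hT
  have hT0 : 0 ≤ T := Finset.sum_nonneg fun _ _ => (Real.exp_pos _).le
  have hTS : T ≤ S := sum_Icc_exp_neg_mul_sq_le hc n
  -- factorisation of the box sum
  have hfac : (∑ k ∈ A ×ˢ (A ×ˢ A), Real.exp (-(c * ((k.1 : ℝ) ^ 2 + (k.2.1 : ℝ) ^ 2 + (k.2.2 : ℝ) ^ 2)))) =
      T * (T * T) := by
    rw [Finset.sum_product]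
    have h1 : ∀ a : ℤ, (∑ q ∈ A ×ˢ A, Real.exp (-(c * (((a, q).1 : ℝ) ^ 2 + ((a, q).2.1 : ℝ) ^ 2 +
        ((a, q).2.2 : ℝ) ^ 2)))) = Real.exp (-(c * (a : ℝ) ^ 2)) * (T * T) := by
      intro a
      rw [Finset.sum_product, hT, Finset.sum_mul_sum, Finset.mul_sum]
      refine Finset.sum_congr rfl fun b _ => ?_
      rw [Finset.mul_sum]
      refine Finset.sum_congr rfl fun d _ => ?_
      rw [← Real.exp_add, ← Real.exp_add]
      congr 1
      ring
    simp_rw [h1]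
    rw [← Finset.sum_mul]
  rw [hfac]
  calc T * (T * T) ≤ S * (S * S) :=
        mul_le_mul hTS (mul_le_mul hTS hTS hT0 (hT0.trans hTS)) (mul_nonneg hT0 hT0) (hT0.trans hTS)
    _ = S ^ 3 := by ring

end Summit.QuantumFields.YangMills.Theorems.ColdStartUniversality

end
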